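import Summits.Parity.GeneralizedHardyLittlewood.Theses.ClassVarianceLadder
import HarnessLib.Audit

/-!
# Birth skeleton (BC3) — crux `TupleClassVariance` (stmt-Parity-13835), route `ClassVarianceLadder`

`Cruxes/TupleClassVariance/Lines/birth.lean` · registrar planner-skel-stmt-Parity-13835-0 · 2026-08-17 ·
mode skeleton-register (route re-audit bin REPAIRABLE). The crux is FIXED and is concluded BY NAME:

  `Summit.Parity.GeneralizedHardyLittlewood.Theses.ClassVarianceLadder.TupleClassVariance`

(rank 4): for every `t ≥ 2`, `L`, `A, ε > 0`, eventually in `N`, for every non-degenerate `d = 1`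
system `Φ` of `t` affine forms with `‖Φ‖_N ≤ L`, every scale `1 ≤ D ≤ N^{1-ε}`, every class
function `c : ℕ → ℤ` and intervals `[u_q, v_q] ⊆ [-N, N]`:
`∑_{D < q ≤ 2D, q squarefree} (T_q(c_q) − ρ_Φ(q, c_q)·T_1)² ≤ N²/(D (log N)^A)`, where
`T_q(c) = ∑_{n ∈ [u_q,v_q], n ≡ c (q)} ∏ᵢ Λ(φᵢ(n))`, `T_1` the unrestricted sum on the same
interval and `ρ_Φ(q, c) = 1[c is q-admissible] / #{q-admissible residues}` (`c` is
`q`-admissible iff `gcd(φᵢ(c), q) = 1` for all `i`) — prime `t`-tuples are equidistributed among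
the admissible classes, ONE class per modulus, in mean square over `q ∼ D`, RELATIVE to their
actual count (HL-free, Möbius-free).

## The cut — three named stubs: the inadmissible sliver, and the admissible classes on the two
## sides of the square-root barrier

The summand of the crux depends on whether the chosen class `c_q` is `q`-admissible.

* INADMISSIBLE classes (`ρ = 0`, summand `= T_q(c_q)²`): some prime `p ∣ q` divides `φᵢ(c_q)`,
  hence `p ∣ φᵢ(n)` for every `n ≡ c_q (q)`, so `Λ(φᵢ(n)) ≠ 0` forces `φᵢ(n) = p^k` with
  `p^k ≤ 2LN`: at most `log₂(2LN) + 1` integers `n` contribute (`aᵢ ≠ 0` by non-degeneracy), each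
  at most `(log 2LN)^t`, so `T_q(c_q) ≤ (log₂(2LN)+1)(log 2LN)^t` and the sliver (at most `2D` moduli)
  is `≪ D·(log 2LN)^{2t+2} ≤ N²/(D(log N)^A)` as soon as `D ≤ N^{1-ε}` and `N ≥ N₀(t,L,A,ε)`.
  This is `stub_inadmissibleClasses` — PROVABLE NOW (size M: prime powers along an affine form,
  `affLinSize` ⇒ `|aᵢ| ≤ L`, `|bᵢ| ≤ LN`), the foothold of the line.
* ADMISSIBLE classes (`ρ = 1/#{admissible residues mod q}`), split at the level of the
  LARGE-SIEVE BARRIER `D = N^{1/2}` (`Literature.Barriers.Parity.LargeSieveLevelHalf`):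
  - `stub_admissibleLevelHalf` — scales `1 ≤ D ≤ N^{1/2}`: the Barban–Davenport–Halberstam /
    Bombieri–Vinogradov RANGE for prime `t`-tuples, one admissible class per modulus, relative
    form (for `t = 1` — the sibling crux `PrimeClassVariance`, not this one — the analogue is known
    for `D ≤ N^{1/2}(log N)^{-B}` from Bombieri–Vinogradov + Siegel–Walfisz,
    `Literature.NumberTheory.Sieve.bombieri_vinogradov`, by the argument of the route's support
    item `EHGivesPrimeClassVariance`; for `t ≥ 2` it is open at EVERY growing modulus — no
    Siegel–Walfisz / Bombieri–Vinogradov theorem for prime tuples is known, only shift-averaged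
    substitutes: Balog 1990, Mikawa 1992, Kawada 1993/1995, Matomäki–Radziwiłł–Tao 2019).
    Technique class: large sieve / Vaughan–Heath-Brown opening of one `Λ` factor / dispersion;
    the catalogued barrier does not bite below `N^{1/2}`.
  - `stub_admissibleBeyondHalf` — scales `N^{1/2} < D ≤ N^{1-ε}`: BEYOND the square-root
    barrier, where the large sieve controls only the all-classes variance and one-class
    statements are Elliott–Halberstam's shadow (for `t = 1`: fixed-class dispersion
    Bombieri–Friedlander–Iwaniec 1986–89, Maynard 2020; Hooley 1975 / Friedlander–Goldston 1996:
    one fixed class = Hardy–Littlewood on average over the 2-slope families `(qk + c, qk' + c)`,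
    `k, k' ≤ N/D`). `LargeSieveLevelHalf` applies to this stub and to this stub only; the
    recorded evasions (dispersion / Kloosterman for a FIXED class) are the intended attack.
  Both admissible stubs are implied by the crux (take `ε = 1/2`, resp. the same `ε`; drop the
  inadmissible moduli, whose terms are squares; evaluate the indicator), neither is known to
  imply the other or the crux, and the crux needs both: the cut is the classical BV-range /
  EH-range dichotomy, drawn exactly where the catalogued barrier starts, plus the provable sliver
  that lets both hard stubs assume admissible classes (`ρ_Φ(q,c_q) = 1/#{admissible residues}`,
  no indicator). The route header's foreseen splits were "t = 2 → general t" for this crux and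
  "BVRange → DispersionWindow → Bulk" for `PrimeClassVariance`; the registrar transfers the
  latter (regime) plan to the tuple crux — a split by `t` has no mechanism behind it (opening one
  `Λ` factor as in `LadderStep` pushes the moduli to `qd > N`), whereas the regime split separates
  two technique classes and two barrier statuses.

`TupleClassVariance_of : Sig… → TupleClassVariance` is PROVED (§3): thresholds
`N₀ = max (max N₁ N₂) (max N₃ N₄)` with the three stubs taken at saving `A + 1` and `log N ≥ 2`
beyond `N₄`; the `q`-sum is split by admissibility of `c_q` (`Finset.sum_filter_add_sum_filter_not`,
the indicator rewritten to `1` resp. `0` on the two parts — lemma `sum_filter_sq_split_le`), the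
admissible part is bounded by `stub_admissibleLevelHalf` or `stub_admissibleBeyondHalf` according
as `D ≤ N^{1/2}` or not, the inadmissible part by `stub_inadmissibleClasses`, and
`2·N²/(D(log N)^{A+1}) ≤ N²/(D(log N)^A)` for `log N ≥ 2`. `lean check`: sorries ONLY in the three
`stub_*` (audit: 3 sorries = 3 stubs, zero elsewhere).

Hardest stub: `stub_admissibleBeyondHalf` (Elliott–Halberstam range for tuples; for `t = 1` the
analogous statement is equivalent, by Cauchy–Schwarz over `q ∼ D`, to EH at level `N^{1-ε}` in
interval form). Registrar's note for the tenure planner (NOTES.md of this seat): by the same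
Cauchy–Schwarz, the crux with ALL savings `A` implies the `L¹` one-class discrepancy bound
`∑_{q∼D} |T_q(c_q) − ρ T_1| ≤ N(log N)^{-A/2}` for every class function, i.e. the relative
Elliott–Halberstam statement for prime `t`-tuples at level `N^{1-ε}`; conversely that `L¹` form
plus a Brun–Titchmarsh bound for tuples in one class gives the crux back — so the `L¹` form was NOT
taken as a stub (it would be the crux in another norm), and the range split is the honest cut.

BC3 probes (registrar, 2026-08-17; files `bc/probe_<Stub>_{crux,summit}.lean` of the registrar's folder,
each importing only this route file and restating the stub verbatim; log attached to the crux item as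
evidence `probes_summary.txt`): for each of the three stub statements `S`, BOTH
`example : S → TupleClassVariance` and `example : S → GeneralizedHardyLittlewood` by
`first | exact? | simpa | aesop` and by `first | exact? | simpa [S] | (unfold S; simpa) | aesop`
(`maxHeartbeats 400000`) FAIL — 6/6 files rc 1: `AdmissibleLevelHalf`, `AdmissibleBeyondHalf` (both
targets) and `InadmissibleClasses → GeneralizedHardyLittlewood` end in `unsolved goals a : S ⊢ target`
after `exact?` and `simpa` fail and `aesop` reports "failed to prove the goal after exhaustive search";
`InadmissibleClasses → TupleClassVariance` times out inside the combined battery and, one tactic per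
example (`bc/probe_InadmissibleClasses_crux_split.lean`), gives `exact?`: deterministic timeout (no
lemma), `simpa` / `simpa [S]` / `unfold S; simpa`: `assumption` failed, `aesop`: exhaustive search
failed. No stub is cheaply the crux or the summit.

Disproof used: none exists for this crux (`ledger crux ls stmt-Parity-13835`: no workfiles, no
`Disproof.lean`, no `Theorems/TupleClassVariance/Negative/*`, 2026-08-17). Negatives index
(`ledger negatives --problem Parity`, 3 entries: PrimeDeterminantCells.ConvMomentLevelOne,
InverseSieveTuples.TupleElliott — pretentious-distance form, shift-divisor blindness —,
ShiftedMultiplicationTable.RectangleChowla): no refuted statement concerns class counts of prime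
tuples; the stubs are restrictions of the crux itself (same binders, same relative density `ρ_Φ`,
which already absorbs primes dividing the shifts — the TupleElliott witness `(n, n + z!)` has
`ρ_Φ(q, c) = 1[(c,q)=1]/φ(q)` for `q ∣ z!` and is harmless here).
-/

set_option linter.unusedVariables false

namespace Summit.Parity.GeneralizedHardyLittlewood.Cruxes.TupleClassVariance.Birth

open scoped BigOperators Topology Manifold Classical MeasureTheory ProbabilityTheory Matrix InnerProductSpace ComplexConjugate ContinuousMap
open Filter Set Function TopologicalSpace MeasureTheory
open Summit.Parity.GeneralizedHardyLittlewood.Theses.ClassVarianceLadder (TupleClassVariance)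

/-! ## §1 Statements of the three stubs as named propositions

(The skeleton audit reads the hypotheses of `TupleClassVariance_of` BY NAME: each head must be a
declared stub, whence the `Goal.stub_*` abbreviations; the registered stubs themselves carry the
statements EXPANDED, §2, so that `ledger skeleton check` records self-contained signatures.) -/

/-- Statement of `stub_inadmissibleClasses` — THE INADMISSIBLE SLIVER: the moduli `q ∼ D` whose chosen class `c_q` is NOT `q`-admissible (`∃ i, gcd(φᵢ(c_q), q) ≠ 1`; there `ρ_Φ(q,c_q) = 0` and the crux summand is `T_q(c_q)²`) contribute `≤ N²/(D (log N)^A)`, for all `1 ≤ D ≤ N^{1-ε}`. True and provable now: on such a class `T_q(c_q)` is a sum over the `≤ log₂(2LN)+1` integers `n` with some `φᵢ(n)` a power of a prime `p ∣ q`. -/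
def InadmissibleClasses : Prop :=
  ∀ t : ℕ, 2 ≤ t → ∀ (L : ℕ) (A ε : ℝ), 0 < A → 0 < ε → ∃ N₀ : ℕ, ∀ N : ℕ, N₀ ≤ N → ∀ Φ : Fin t → Literature.NumberTheory.Sieve.AffLinForm 1, Literature.NumberTheory.Sieve.IsNondegenerateSystem Φ → Literature.NumberTheory.Sieve.affLinSize Φ N ≤ L → ∀ D : ℝ, 1 ≤ D → D ≤ (N : ℝ) ^ (1 - ε) → ∀ c u v : ℕ → ℤ, (∀ q, -(N : ℤ) ≤ u q ∧ v q ≤ N) → ∑ q ∈ ((Finset.Ioc ⌊D⌋₊ ⌊2 * D⌋₊).filter Squarefree).filter (fun q : ℕ => ¬ (∀ i, Int.gcd ((Φ i).eval fun _ => (c q)) q = 1)), (∑ n ∈ (Finset.Icc (u q) (v q)).filter (fun n : ℤ => ((q : ℕ) : ℤ) ∣ n - (c q)), ∏ i, Literature.NumberTheory.Sieve.intVonMangoldt ((Φ i).eval fun _ => n)) ^ 2 ≤ (N : ℝ) ^ 2 / (D * Real.log N ^ A)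

/-- Statement of `stub_admissibleLevelHalf` — ADMISSIBLE CLASSES, LARGE-SIEVE RANGE `1 ≤ D ≤ N^{1/2}`: the crux's relative mean square restricted to the moduli whose class `c_q` is `q`-admissible (so `ρ_Φ(q,c_q) = 1/#{admissible residues mod q}`), for scales up to the square-root barrier; no `ε` is needed in this range. -/
def AdmissibleLevelHalf : Prop :=
  ∀ t : ℕ, 2 ≤ t → ∀ (L : ℕ) (A : ℝ), 0 < A → ∃ N₀ : ℕ, ∀ N : ℕ, N₀ ≤ N → ∀ Φ : Fin t → Literature.NumberTheory.Sieve.AffLinForm 1, Literature.NumberTheory.Sieve.IsNondegenerateSystem Φ → Literature.NumberTheory.Sieve.affLinSize Φ N ≤ L → ∀ D : ℝ, 1 ≤ D → D ≤ (N : ℝ) ^ (1 / 2 : ℝ) → ∀ c u v : ℕ → ℤ, (∀ q, -(N : ℤ) ≤ u q ∧ v q ≤ N) → ∑ q ∈ ((Finset.Ioc ⌊D⌋₊ ⌊2 * D⌋₊).filter Squarefree).filter (fun q : ℕ => ∀ i, Int.gcd ((Φ i).eval fun _ => (c q)) q = 1), ((∑ n ∈ (Finset.Icc (u q) (v q)).filter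 (fun n : ℤ => ((q : ℕ) : ℤ) ∣ n - (c q)), ∏ i, Literature.NumberTheory.Sieve.intVonMangoldt ((Φ i).eval fun _ => n)) - (1 / ((((Finset.range q).filter fun r : ℕ => ∀ i, Int.gcd ((Φ i).eval fun _ => (r : ℤ)) q = 1).card : ℕ) : ℝ)) * (∑ n ∈ Finset.Icc (u q) (v q), ∏ i, Literature.NumberTheory.Sieve.intVonMangoldt ((Φ i).eval fun _ => n))) ^ 2 ≤ (N : ℝ) ^ 2 / (D * Real.log N ^ A)

/-- Statement of `stub_admissibleBeyondHalf` — ADMISSIBLE CLASSES BEYOND THE SQUARE-ROOT BARRIER `N^{1/2} < D ≤ N^{1-ε}`: the same relative mean square over admissible classes in the Elliott–Halberstam range (`Literature.Barriers.Parity.LargeSieveLevelHalf` applies here and only here). -/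
def AdmissibleBeyondHalf : Prop :=
  ∀ t : ℕ, 2 ≤ t → ∀ (L : ℕ) (A ε : ℝ), 0 < A → 0 < ε → ∃ N₀ : ℕ, ∀ N : ℕ, N₀ ≤ N → ∀ Φ : Fin t → Literature.NumberTheory.Sieve.AffLinForm 1, Literature.NumberTheory.Sieve.IsNondegenerateSystem Φ → Literature.NumberTheory.Sieve.affLinSize Φ N ≤ L → ∀ D : ℝ, (N : ℝ) ^ (1 / 2 : ℝ) < D → D ≤ (N : ℝ) ^ (1 - ε) → ∀ c u v : ℕ → ℤ, (∀ q, -(N : ℤ) ≤ u q ∧ v q ≤ N) → ∑ q ∈ ((Finset.Ioc ⌊D⌋₊ ⌊2 * D⌋₊).filter Squarefree).filter (fun q : ℕ => ∀ i, Int.gcd ((Φ i).eval fun _ => (c q)) q = 1), ((∑ n ∈ (Finset.Icc (u q) (v q)).filter (fun n : ℤ => ((q : ℕ) : ℤ) ∣ n - (c q)), ∏ i, Literature.NumberTheory.Sieve.intVonMangoldt ((Φ i).eval fun _ => n)) - (1 / ((((Finset.range q).filter fun r : ℕ => ∀ i, Int.gcd ((Φ i).eval fun _ => (r : ℤ)) q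 = 1).card : ℕ) : ℝ)) * (∑ n ∈ Finset.Icc (u q) (v q), ∏ i, Literature.NumberTheory.Sieve.intVonMangoldt ((Φ i).eval fun _ => n))) ^ 2 ≤ (N : ℝ) ^ 2 / (D * Real.log N ^ A)

namespace Goal
/-- Statement of `stub_inadmissibleClasses`, under the stub's name. -/
abbrev stub_inadmissibleClasses : Prop := InadmissibleClasses
/-- Statement of `stub_admissibleLevelHalf`, under the stub's name. -/
abbrev stub_admissibleLevelHalf : Prop := AdmissibleLevelHalf
/-- Statement of `stub_admissibleBeyondHalf`, under the stub's name. -/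
abbrev stub_admissibleBeyondHalf : Prop := AdmissibleBeyondHalf
end Goal

/-! ## §2 Registered stubs (the only `sorry`s of the file), stated expanded -/

/-- stub 1 — THE INADMISSIBLE SLIVER (provable now, size M): moduli `q ∈ (D, 2D]`, squarefree, whose class `c_q` is not `q`-admissible carry `∑ T_q(c_q)² ≤ N²/(D (log N)^A)` for `1 ≤ D ≤ N^{1-ε}`, `N ≥ N₀(t, L, A, ε)` (prime powers `p^k ≤ 2LN`, `p ∣ q`, along one form: `T_q(c_q) ≤ (log₂(2LN)+1)(log 2LN)^t`, at most `2D` moduli, `D ≤ N^{1-ε}`). -/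
theorem stub_inadmissibleClasses : ∀ t : ℕ, 2 ≤ t → ∀ (L : ℕ) (A ε : ℝ), 0 < A → 0 < ε → ∃ N₀ : ℕ, ∀ N : ℕ, N₀ ≤ N → ∀ Φ : Fin t → Literature.NumberTheory.Sieve.AffLinForm 1, Literature.NumberTheory.Sieve.IsNondegenerateSystem Φ → Literature.NumberTheory.Sieve.affLinSize Φ N ≤ L → ∀ D : ℝ, 1 ≤ D → D ≤ (N : ℝ) ^ (1 - ε) → ∀ c u v : ℕ → ℤ, (∀ q, -(N : ℤ) ≤ u q ∧ v q ≤ N) → ∑ q ∈ ((Finset.Ioc ⌊D⌋₊ ⌊2 * D⌋₊).filter Squarefree).filter (fun q : ℕ => ¬ (∀ i, Int.gcd ((Φ i).eval fun _ => (c q)) q = 1)), (∑ n ∈ (Finset.Icc (u q) (v q)).filter (fun n : ℤ => ((q : ℕ) : ℤ) ∣ n - (c q)), ∏ i, Literature.NumberTheory.Sieve.intVonMangoldt ((Φ i).eval fun _ => n)) ^ 2 ≤ (N : ℝ) ^ 2 / (D * Real.log N ^ A) := by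
  sorry

/-- stub 2 — ADMISSIBLE CLASSES IN THE LARGE-SIEVE RANGE (open for `t ≥ 2`; BV + Siegel–Walfisz give the `t = 1` analogue): for `1 ≤ D ≤ N^{1/2}`, `∑_{q ∼ D, squarefree, c_q admissible} (T_q(c_q) − T_1/#{admissible residues mod q})² ≤ N²/(D (log N)^A)`, `N ≥ N₀(t, L, A)`. -/
theorem stub_admissibleLevelHalf : ∀ t : ℕ, 2 ≤ t → ∀ (L : ℕ) (A : ℝ), 0 < A → ∃ N₀ : ℕ, ∀ N : ℕ, N₀ ≤ N → ∀ Φ : Fin t → Literature.NumberTheory.Sieve.AffLinForm 1, Literature.NumberTheory.Sieve.IsNondegenerateSystem Φ → Literature.NumberTheory.Sieve.affLinSize Φ N ≤ L → ∀ D : ℝ, 1 ≤ D → D ≤ (N : ℝ) ^ (1 / 2 : ℝ) → ∀ c u v : ℕ → ℤ, (∀ q, -(N : ℤ) ≤ u q ∧ v q ≤ N) → ∑ q ∈ ((Finset.Ioc ⌊D⌋₊ ⌊2 * D⌋₊).filter Squarefree).filter (fun q : ℕ => ∀ i, Int.gcd ((Φ i).eval fun _ => (c q)) q = 1), ((∑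 n ∈ (Finset.Icc (u q) (v q)).filter (fun n : ℤ => ((q : ℕ) : ℤ) ∣ n - (c q)), ∏ i, Literature.NumberTheory.Sieve.intVonMangoldt ((Φ i).eval fun _ => n)) - (1 / ((((Finset.range q).filter fun r : ℕ => ∀ i, Int.gcd ((Φ i).eval fun _ => (r : ℤ)) q = 1).card : ℕ) : ℝ)) * (∑ n ∈ Finset.Icc (u q) (v q), ∏ i, Literature.NumberTheory.Sieve.intVonMangoldt ((Φ i).eval fun _ => n))) ^ 2 ≤ (N : ℝ) ^ 2 / (D * Real.log N ^ A) := by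
  sorry

/-- stub 3 — ADMISSIBLE CLASSES BEYOND THE SQUARE-ROOT BARRIER (open; Elliott–Halberstam range, hardest): for `N^{1/2} < D ≤ N^{1-ε}`, `∑_{q ∼ D, squarefree, c_q admissible} (T_q(c_q) − T_1/#{admissible residues mod q})² ≤ N²/(D (log N)^A)`, `N ≥ N₀(t, L, A, ε)`. -/
theorem stub_admissibleBeyondHalf : ∀ t : ℕ, 2 ≤ t → ∀ (L : ℕ) (A ε : ℝ), 0 < A → 0 < ε → ∃ N₀ : ℕ, ∀ N : ℕ, N₀ ≤ N → ∀ Φ : Fin t → Literature.NumberTheory.Sieve.AffLinForm 1, Literature.NumberTheory.Sieve.IsNondegenerateSystem Φ → Literature.NumberTheory.Sieve.affLinSize Φ N ≤ L → ∀ D : ℝ, (N : ℝ) ^ (1 / 2 : ℝ) < D → D ≤ (N : ℝ) ^ (1 - ε) → ∀ c u v : ℕ → ℤ, (∀ q, -(N : ℤ) ≤ u q ∧ v q ≤ N) → ∑ q ∈ ((Finset.Ioc ⌊D⌋₊ ⌊2 * D⌋₊).filter Squarefree).filter (fun q : ℕ => ∀ i, Int.gcd ((Φ i).eval fun _ =>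 (c q)) q = 1), ((∑ n ∈ (Finset.Icc (u q) (v q)).filter (fun n : ℤ => ((q : ℕ) : ℤ) ∣ n - (c q)), ∏ i, Literature.NumberTheory.Sieve.intVonMangoldt ((Φ i).eval fun _ => n)) - (1 / ((((Finset.range q).filter fun r : ℕ => ∀ i, Int.gcd ((Φ i).eval fun _ => (r : ℤ)) q = 1).card : ℕ) : ℝ)) * (∑ n ∈ Finset.Icc (u q) (v q), ∏ i, Literature.NumberTheory.Sieve.intVonMangoldt ((Φ i).eval fun _ => n))) ^ 2 ≤ (N : ℝ) ^ 2 / (D * Real.log N ^ A) := by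
  sorry

/-! Consistency (elaborated, not kept in the environment): each expanded stub statement is, by
`δ`-unfolding, the named proposition the composition consumes. -/
example : Goal.stub_inadmissibleClasses := stub_inadmissibleClasses
example : Goal.stub_admissibleLevelHalf := stub_admissibleLevelHalf
example : Goal.stub_admissibleBeyondHalf := stub_admissibleBeyondHalf

/-! ## §3 The composition (kernel-checked; no `sorry` of its own) -/

/-- Splitting a sum of squared class deviations by admissibility of the class: on the part of `s`
where `p` holds the indicator in the relative density is `1`, elsewhere it is `0` and the summand
is the bare square; two bounds `≤ B'` and `B' + B' ≤ B` give the bound `B` for the whole sum. -/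
theorem sum_filter_sq_split_le {ι : Type*} (s : Finset ι) (p : ι → Prop) [DecidablePred p]
    (T T₁ κ : ι → ℝ) {B B' : ℝ}
    (hadm : ∑ q ∈ s.filter (fun q => p q), (T q - (1 / κ q) * T₁ q) ^ 2 ≤ B')
    (hin : ∑ q ∈ s.filter (fun q => ¬ p q), T q ^ 2 ≤ B')
    (hB : B' + B' ≤ B) :
    ∑ q ∈ s, (T q - ((if p q then (1 : ℝ) else 0) / κ q) * T₁ q) ^ 2 ≤ B := by
  have hsplit := Finset.sum_filter_add_sum_filter_not s p
    (fun q => (T q - ((if p q then (1 : ℝ) else 0) / κ q) * T₁ q) ^ 2)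
  have h1 : ∑ q ∈ s.filter (fun q => p q), (T q - ((if p q then (1 : ℝ) else 0) / κ q) * T₁ q) ^ 2
      = ∑ q ∈ s.filter (fun q => p q), (T q - (1 / κ q) * T₁ q) ^ 2 :=
    Finset.sum_congr rfl fun q hq => by rw [if_pos (Finset.mem_filter.1 hq).2]
  have h2 : ∑ q ∈ s.filter (fun q => ¬ p q), (T q - ((if p q then (1 : ℝ) else 0) / κ q) * T₁ q) ^ 2
      = ∑ q ∈ s.filter (fun q => ¬ p q), T q ^ 2 :=
    Finset.sum_congr rfl fun q hq => by
      rw [if_neg (Finset.mem_filter.1 hq).2, zero_div, zero_mul, sub_zero]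
  rw [← hsplit, h1, h2]
  linarith

/-- THE CRUX BY NAME from the three registered stubs: thresholds at saving `A + 1` (and `log N ≥ 2`),
the `q`-sum split by admissibility of `c_q`, the admissible part by `stub_admissibleLevelHalf` /
`stub_admissibleBeyondHalf` according as `D ≤ N^{1/2}` or `N^{1/2} < D`, the inadmissible part by
`stub_inadmissibleClasses`, and `2 N²/(D (log N)^{A+1}) ≤ N²/(D (log N)^A)`. -/
theorem TupleClassVariance_of :
    Goal.stub_inadmissibleClasses → Goal.stub_admissibleLevelHalf → Goal.stub_admissibleBeyondHalf →
      Summit.Parity.GeneralizedHardyLittlewood.Theses.ClassVarianceLadder.TupleClassVariance := by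
  intro hIn hSm hLg t ht L A ε hA hε
  have hA1 : 0 < A + 1 := by linarith
  obtain ⟨N₁, h₁⟩ := hIn t ht L (A + 1) ε hA1 hε
  obtain ⟨N₂, h₂⟩ := hSm t ht L (A + 1) hA1
  obtain ⟨N₃, h₃⟩ := hLg t ht L (A + 1) ε hA1 hε
  obtain ⟨N₄, h₄⟩ : ∃ N₄ : ℕ, ∀ N : ℕ, N₄ ≤ N → (2 : ℝ) ≤ Real.log N := by
    have h := (Real.tendsto_log_atTop.comp tendsto_natCast_atTop_atTop).eventually_ge_atTop (2 : ℝ)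
    obtain ⟨N₄, hN₄⟩ := Filter.eventually_atTop.1 h
    exact ⟨N₄, fun N hN => hN₄ N hN⟩
  refine ⟨max (max N₁ N₂) (max N₃ N₄), fun N hN Φ hΦ hL D hD1 hD2 c u v huv => ?_⟩
  obtain ⟨h12, h34⟩ := max_le_iff.1 hN
  obtain ⟨hN₁, hN₂⟩ := max_le_iff.1 h12
  obtain ⟨hN₃, hN₄⟩ := max_le_iff.1 h34
  have hlog2 : (2 : ℝ) ≤ Real.log N := h₄ N hN₄
  have hlogpos : 0 < Real.log N := by linarith
  have hDpos : 0 < D := by linarith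
  have hBB : (N : ℝ) ^ 2 / (D * Real.log N ^ (A + 1)) + (N : ℝ) ^ 2 / (D * Real.log N ^ (A + 1))
      ≤ (N : ℝ) ^ 2 / (D * Real.log N ^ A) := by
    rw [Real.rpow_add_one hlogpos.ne' A]
    have hX : 0 ≤ (N : ℝ) ^ 2 / (D * Real.log N ^ A) := by positivity
    have hre : (N : ℝ) ^ 2 / (D * (Real.log N ^ A * Real.log N))
        = (N : ℝ) ^ 2 / (D * Real.log N ^ A) / Real.log N := by
      rw [div_div, mul_assoc]
    rw [hre]
    have h5 : (N : ℝ) ^ 2 / (D * Real.log N ^ A) / Real.log N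
        ≤ (N : ℝ) ^ 2 / (D * Real.log N ^ A) / 2 :=
      div_le_div_of_nonneg_left hX (by norm_num) hlog2
    linarith
  have hin := h₁ N hN₁ Φ hΦ hL D hD1 hD2 c u v huv
  rcases le_or_gt D ((N : ℝ) ^ (1 / 2 : ℝ)) with hDs | hDl
  · exact sum_filter_sq_split_le _ _ _ _ _ (h₂ N hN₂ Φ hΦ hL D hD1 hDs c u v huv) hin hBB
  · exact sum_filter_sq_split_le _ _ _ _ _ (h₃ N hN₃ Φ hΦ hL D hDl hD2 c u v huv) hin hBB

end Summit.Parity.GeneralizedHardyLittlewood.Cruxes.TupleClassVariance.Birth
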